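import Mathlib
import Summits.KontsevichZagierPeriods.Zeta5Search.Families.DualRateDictionary
import Summits.KontsevichZagierPeriods.Zeta5Search.Families.DualRateTables
import HarnessLib

/-!
# ζ(5) search — Families: CONJECTURE D, the degenerate cone, II — the dual ray function is unbounded when a gap
# condition fails

HONEST FRAMING: systematic search; no irrationality claim unless certified.  Cell `pub-zeta5`, certifier 2
(cert-2 g9, 2026-08-22).  Elementary real analysis; nothing about `ζ(5)`; no conjecture node is used.

* `phiZ a g` — the dual ray function as a function of six positive gaps (integer exponents), `rayF_dual_eq_phiZ`,
  and its scale invariance `phiZ_smul` (Brown's homogeneity `Σ_gaps bzDen = Σ_edges bzNum`, an identity in `a`);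
* **`raySup_dual_eq_zero_of_gapFail`** — if for a set of gaps `W` the integer
  `Σ_{w ∈ W} bzDen_w − Σ_{e : span e ⊆ W} bzNum_e` is negative (and `bzNum a ≥ 0`), then the dual ray function is
  unbounded on the simplex (shrink the gaps in `W`), so `raySup(₈π₈; bzDen a, bzNum a) = sSup(unbounded) = 0`.
Standard axioms only.
-/

noncomputable section

open Finset Real Filter Topology

namespace Summit.KontsevichZagierPeriods.Zeta5Search.Families.Cellular

open Literature.NumberTheory.Irrationality CoeffAsymp DualCT

namespace DualRate

/-! ## The dual ray function of the gaps -/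

/-- The six gap exponents `B_w = bzDen a w` (`w < 6`). -/
def gapZ (a : Fin 8 → ℤ) : Fin 6 → ℤ :=
  ![bzDen a 0, bzDen a 1, bzDen a 2, bzDen a 3, bzDen a 4, bzDen a 5]

/-- The linear form of an edge evaluated at `g`. -/
def spanSum (e : Fin 6) (g : Fin 6 → ℝ) : ℝ := ∑ w ∈ span6 e, g w

/-- The dual ray function as a function of the gaps: `∏_w g_w^{B_w} / ∏_e (Σ_{span e} g)^{A_e}` (integer powers). -/
def phiZ (a : Fin 8 → ℤ) (g : Fin 6 → ℝ) : ℝ :=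
  (∏ w : Fin 6, g w ^ gapZ a w) / ∏ e : Fin 6, spanSum e g ^ bzNum a (edge6 e)

/-- The span sums, explicitly. -/
theorem spanSum_eq (g : Fin 6 → ℝ) : spanSum 0 g = g 1 + g 2 ∧ spanSum 1 g = g 1 + g 2 + g 3 + g 4 + g 5 ∧
    spanSum 2 g = g 2 + g 3 + g 4 + g 5 ∧ spanSum 3 g = g 2 + g 3 + g 4 ∧ spanSum 4 g = g 0 + g 1 + g 2 + g 3 ∧
    spanSum 5 g = g 0 + g 1 + g 2 := by
  refine ⟨?_, ?_, ?_, ?_, ?_, ?_⟩ <;> simp [spanSum, span6] <;> ring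

/-- **`rayF = phiZ ∘ gaps`.** -/
theorem rayF_dual_eq_phiZ (a : Fin 8 → ℤ) (t : Fin 5 → ℝ) :
    rayF pi8dualInv (bzDen a) (bzNum a) t = phiZ a (gap t) := by
  obtain ⟨s0, s1, s2, s3, s4, s5⟩ := spanSum_eq (gap t)
  rw [rayF_dual_zpow, phiZ, Fin.prod_univ_six, Fin.prod_univ_six, s0, s1, s2, s3, s4, s5]
  have g0 : gap t 0 = t 0 := by simp [gap, pt]
  have g1 : gap t 1 = t 1 - t 0 := by simp [gap, pt]
  have g2 : gap t 2 = t 2 - t 1 := by simp [gap, pt]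
  have g3 : gap t 3 = t 3 - t 2 := by simp [gap, pt]
  have g4 : gap t 4 = t 4 - t 3 := by simp [gap, pt]
  have g5 : gap t 5 = 1 - t 4 := by simp [gap, pt]
  rw [g0, g1, g2, g3, g4, g5]
  have e0 : t 1 - t 0 + (t 2 - t 1) = t 2 - t 0 := by ring
  have e1 : t 1 - t 0 + (t 2 - t 1) + (t 3 - t 2) + (t 4 - t 3) + (1 - t 4) = 1 - t 0 := by ring
  have e2 : t 2 - t 1 + (t 3 - t 2) + (t 4 - t 3) + (1 - t 4) = 1 - t 1 := by ring
  have e3 : t 2 - t 1 + (t 3 - t 2) + (t 4 - t 3) = t 4 - t 1 := by ring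
  have e4 : t 0 + (t 1 - t 0) + (t 2 - t 1) + (t 3 - t 2) = t 3 := by ring
  have e5 : t 0 + (t 1 - t 0) + (t 2 - t 1) = t 2 := by ring
  rw [e1, e2, e4, e0, e3, e5]
  simp [gapZ, edge6]

/-- Brown's homogeneity for the dual ray: `Σ_{w<6} bzDen a w = Σ_{finite edges} bzNum a e` (all `a`). -/
theorem sum_gapZ_eq (a : Fin 8 → ℤ) :
    gapZ a 0 + gapZ a 1 + gapZ a 2 + gapZ a 3 + gapZ a 4 + gapZ a 5 =
      bzNum a 0 + bzNum a 1 + bzNum a 2 + bzNum a 3 + bzNum a 6 + bzNum a 7 := by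
  simp [gapZ, bzNum, bzDen, BrownZudilin2022.b24, BrownZudilin2022.b14, BrownZudilin2022.b57, BrownZudilin2022.b35]
  ring

/-- **Scale invariance** `phiZ a (s·g) = phiZ a g` (`s ≠ 0`). -/
theorem phiZ_smul (a : Fin 8 → ℤ) {s : ℝ} (hs : s ≠ 0) (g : Fin 6 → ℝ) :
    phiZ a (fun w => s * g w) = phiZ a g := by
  obtain ⟨s0, s1, s2, s3, s4, s5⟩ := spanSum_eq (fun w => s * g w)
  obtain ⟨r0, r1, r2, r3, r4, r5⟩ := spanSum_eq g
  unfold phiZ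
  rw [Fin.prod_univ_six, Fin.prod_univ_six, Fin.prod_univ_six, Fin.prod_univ_six, s0, s1, s2, s3, s4, s5,
    r0, r1, r2, r3, r4, r5]
  have e0 : s * g 1 + s * g 2 = s * (g 1 + g 2) := by ring
  have e1 : s * g 1 + s * g 2 + s * g 3 + s * g 4 + s * g 5 = s * (g 1 + g 2 + g 3 + g 4 + g 5) := by ring
  have e2 : s * g 2 + s * g 3 + s * g 4 + s * g 5 = s * (g 2 + g 3 + g 4 + g 5) := by ring
  have e3 : s * g 2 + s * g 3 + s * g 4 = s * (g 2 + g 3 + g 4) := by ring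
  have e4 : s * g 0 + s * g 1 + s * g 2 + s * g 3 = s * (g 0 + g 1 + g 2 + g 3) := by ring
  have e5 : s * g 0 + s * g 1 + s * g 2 = s * (g 0 + g 1 + g 2) := by ring
  rw [e1, e2, e4, e0, e3, e5]
  simp only [mul_zpow, show edge6 0 = 0 from rfl, show edge6 1 = 1 from rfl, show edge6 2 = 2 from rfl,
    show edge6 3 = 3 from rfl, show edge6 4 = 6 from rfl, show edge6 5 = 7 from rfl]
  -- collect the powers of `s`
  have hS : s ^ gapZ a 0 * s ^ gapZ a 1 * s ^ gapZ a 2 * s ^ gapZ a 3 * s ^ gapZ a 4 * s ^ gapZ a 5 =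
      s ^ bzNum a 0 * s ^ bzNum a 1 * s ^ bzNum a 2 * s ^ bzNum a 3 * s ^ bzNum a 6 * s ^ bzNum a 7 := by
    rw [← zpow_add₀ hs, ← zpow_add₀ hs, ← zpow_add₀ hs, ← zpow_add₀ hs, ← zpow_add₀ hs,
      ← zpow_add₀ hs, ← zpow_add₀ hs, ← zpow_add₀ hs, ← zpow_add₀ hs, ← zpow_add₀ hs, sum_gapZ_eq]
  have hSne : s ^ bzNum a 0 * s ^ bzNum a 1 * s ^ bzNum a 2 * s ^ bzNum a 3 * s ^ bzNum a 6 * s ^ bzNum a 7 ≠ 0 := by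
    apply_rules [mul_ne_zero, zpow_ne_zero]
  rw [show s ^ gapZ a 0 * g 0 ^ gapZ a 0 * (s ^ gapZ a 1 * g 1 ^ gapZ a 1) * (s ^ gapZ a 2 * g 2 ^ gapZ a 2) *
      (s ^ gapZ a 3 * g 3 ^ gapZ a 3) * (s ^ gapZ a 4 * g 4 ^ gapZ a 4) * (s ^ gapZ a 5 * g 5 ^ gapZ a 5) =
      (s ^ gapZ a 0 * s ^ gapZ a 1 * s ^ gapZ a 2 * s ^ gapZ a 3 * s ^ gapZ a 4 * s ^ gapZ a 5) *
      (g 0 ^ gapZ a 0 * g 1 ^ gapZ a 1 * g 2 ^ gapZ a 2 * g 3 ^ gapZ a 3 * g 4 ^ gapZ a 4 * g 5 ^ gapZ a 5) by ring,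
    show s ^ bzNum a 0 * (g 1 + g 2) ^ bzNum a 0 * (s ^ bzNum a 1 * (g 1 + g 2 + g 3 + g 4 + g 5) ^ bzNum a 1) *
      (s ^ bzNum a 2 * (g 2 + g 3 + g 4 + g 5) ^ bzNum a 2) * (s ^ bzNum a 3 * (g 2 + g 3 + g 4) ^ bzNum a 3) *
      (s ^ bzNum a 6 * (g 0 + g 1 + g 2 + g 3) ^ bzNum a 6) * (s ^ bzNum a 7 * (g 0 + g 1 + g 2) ^ bzNum a 7) =
      (s ^ bzNum a 0 * s ^ bzNum a 1 * s ^ bzNum a 2 * s ^ bzNum a 3 * s ^ bzNum a 6 * s ^ bzNum a 7) *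
      ((g 1 + g 2) ^ bzNum a 0 * (g 1 + g 2 + g 3 + g 4 + g 5) ^ bzNum a 1 * (g 2 + g 3 + g 4 + g 5) ^ bzNum a 2 *
      (g 2 + g 3 + g 4) ^ bzNum a 3 * (g 0 + g 1 + g 2 + g 3) ^ bzNum a 6 * (g 0 + g 1 + g 2) ^ bzNum a 7) by ring,
    hS, mul_div_mul_left _ _ hSne]

/-! ## Unboundedness -/

/-- `∏_{w ∈ W} ε^{f w} = ε^{Σ_W f}` for `ε ≠ 0`. -/
theorem prod_zpow_eq {ε : ℝ} (hε : ε ≠ 0) (W : Finset (Fin 6)) (f : Fin 6 → ℤ) :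
    ∏ w ∈ W, ε ^ f w = ε ^ ∑ w ∈ W, f w := by
  classical
  induction W using Finset.induction_on with
  | empty => simp
  | @insert w W hw ih => rw [Finset.prod_insert hw, Finset.sum_insert hw, ih, zpow_add₀ hε]

/-- **Unbounded dual ray function**: if `bzNum a ≥ 0` and for a set of gaps `W`
`Σ_{w ∈ W} bzDen_w < Σ_{e : span e ⊆ W} bzNum_e`, then `raySup(₈π₈; bzDen a, bzNum a) = 0` (the set of values is
not bounded above, and `sSup` of such a set is `0`). -/
theorem raySup_dual_eq_zero_of_gapFail {a : Fin 8 → ℤ} (hA : ∀ i, 0 ≤ bzNum a i) (W : Finset (Fin 6))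
    (hneg : ∑ w ∈ W, gapZ a w < ∑ e ∈ Finset.univ.filter (fun e : Fin 6 => span6 e ⊆ W), bzNum a (edge6 e)) :
    raySup pi8dualInv (bzDen a) (bzNum a) = 0 := by
  classical
  -- data
  set n : Fin 6 → ℕ := fun e => numExp a (edge6 e) with hn
  have hAn : ∀ e : Fin 6, bzNum a (edge6 e) = (n e : ℤ) := fun e => (Int.toNat_of_nonneg (hA _)).symm
  set Nsum : ℕ := ∑ e, n e with hNsum
  set aW : ℕ := ∑ e ∈ Finset.univ.filter (fun e : Fin 6 => span6 e ⊆ W), n e with haW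
  set bW : ℤ := ∑ w ∈ W, gapZ a w with hbW
  have hexp : bW - aW ≤ -1 := by
    have : (∑ e ∈ Finset.univ.filter (fun e : Fin 6 => span6 e ⊆ W), bzNum a (edge6 e)) = (aW : ℤ) := by
      rw [haW, Nat.cast_sum]; exact Finset.sum_congr rfl fun e _ => hAn e
    rw [this] at hneg; omega
  -- the family of gaps `g_ε`
  set gε : ℝ → Fin 6 → ℝ := fun ε w => if w ∈ W then ε else 1 with hgε
  have hgpos : ∀ ε, 0 < ε → ∀ w, 0 < gε ε w := fun ε hε w => by
    simp only [hgε]; split_ifs; exact hε; exact one_pos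
  -- numerator
  have hnum : ∀ ε, ε ≠ 0 → (∏ w : Fin 6, gε ε w ^ gapZ a w) = ε ^ bW := by
    intro ε hε
    have : (fun w => gε ε w ^ gapZ a w) = fun w => if w ∈ W then ε ^ gapZ a w else 1 := by
      funext w; simp only [hgε]; split_ifs <;> simp
    rw [this, Finset.prod_ite_mem, Finset.univ_inter, prod_zpow_eq hε]
  -- denominator bounds
  have hspan_le : ∀ ε, 0 < ε → ε ≤ 1 → ∀ e, spanSum e (gε ε) ≤ 6 := by
    intro ε hε hε1 e
    unfold spanSum
    calc ∑ w ∈ span6 e, gε ε w ≤ ∑ w ∈ span6 e, (1 : ℝ) := Finset.sum_le_sum fun w _ => by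
            simp only [hgε]; split_ifs; exact hε1; exact le_rfl
      _ = (span6 e).card := by simp
      _ ≤ 6 := by exact_mod_cast (Finset.card_le_univ (span6 e)).trans (by simp)
  have hspan_leW : ∀ ε, 0 < ε → ∀ e, span6 e ⊆ W → spanSum e (gε ε) ≤ 6 * ε := by
    intro ε hε e he
    unfold spanSum
    calc ∑ w ∈ span6 e, gε ε w = ∑ w ∈ span6 e, ε := Finset.sum_congr rfl fun w hw => by
            simp only [hgε, he hw, if_true]
      _ = (span6 e).card * ε := by simp
      _ ≤ 6 * ε := by
          refine mul_le_mul_of_nonneg_right ?_ hε.le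
          exact_mod_cast (Finset.card_le_univ (span6 e)).trans (by simp)
  have hspan_pos : ∀ ε, 0 < ε → ∀ e, 0 < spanSum e (gε ε) := by
    intro ε hε e
    unfold spanSum
    refine Finset.sum_pos (fun w _ => hgpos ε hε w) ?_
    fin_cases e <;> simp [span6]
  have hden : ∀ ε, 0 < ε → ε ≤ 1 →
      (∏ e : Fin 6, spanSum e (gε ε) ^ bzNum a (edge6 e)) ≤ (6 : ℝ) ^ Nsum * ε ^ aW ∧
      0 < ∏ e : Fin 6, spanSum e (gε ε) ^ bzNum a (edge6 e) := by
    intro ε hε hε1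
    simp_rw [hAn, zpow_natCast]
    refine ⟨?_, Finset.prod_pos fun e _ => pow_pos (hspan_pos ε hε e) _⟩
    calc ∏ e : Fin 6, spanSum e (gε ε) ^ n e
        ≤ ∏ e : Fin 6, (if span6 e ⊆ W then (6 * ε) ^ n e else (6 : ℝ) ^ n e) := by
          refine Finset.prod_le_prod (fun e _ => pow_nonneg (hspan_pos ε hε e).le _) fun e _ => ?_
          split_ifs with he
          · exact pow_le_pow_left₀ (hspan_pos ε hε e).le (hspan_leW ε hε e he) _
          · exact pow_le_pow_left₀ (hspan_pos ε hε e).le (hspan_le ε hε hε1 e) _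
      _ = (6 : ℝ) ^ Nsum * ε ^ aW := by
          have : (fun e => if span6 e ⊆ W then (6 * ε) ^ n e else (6 : ℝ) ^ n e) =
              fun e => (6 : ℝ) ^ n e * (if span6 e ⊆ W then ε ^ n e else 1) := by
            funext e; split_ifs <;> simp [mul_pow]
          rw [this, Finset.prod_mul_distrib, Finset.prod_pow_eq_pow_sum, Finset.prod_ite, Finset.prod_const_one,
            mul_one, Finset.prod_pow_eq_pow_sum]
  -- the lower bound `phiZ a g_ε ≥ ε⁻¹ / 6^N` for `0 < ε ≤ 1`
  have hphi : ∀ ε, 0 < ε → ε ≤ 1 → ε⁻¹ / (6 : ℝ) ^ Nsum ≤ phiZ a (gε ε) := by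
    intro ε hε hε1
    obtain ⟨hD, hDpos⟩ := hden ε hε hε1
    unfold phiZ
    rw [hnum ε hε.ne']
    have h6 : (0 : ℝ) < (6 : ℝ) ^ Nsum := by positivity
    have h1 : ε ^ bW / ((6 : ℝ) ^ Nsum * ε ^ aW) ≤ ε ^ bW / ∏ e : Fin 6, spanSum e (gε ε) ^ bzNum a (edge6 e) :=
      div_le_div_of_nonneg_left (zpow_nonneg hε.le _) hDpos hD
    refine le_trans ?_ h1
    rw [show ε ^ bW / ((6 : ℝ) ^ Nsum * ε ^ aW) = ε ^ (bW - aW) / (6 : ℝ) ^ Nsum by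
      rw [zpow_sub₀ hε.ne', zpow_natCast]; field_simp]
    refine div_le_div_of_nonneg_right ?_ h6.le
    rw [← zpow_neg_one]
    exact zpow_le_zpow_right_of_le_one₀ hε hε1 hexp
  -- unboundedness of the image
  have hnot : ¬ BddAbove (rayF pi8dualInv (bzDen a) (bzNum a) '' openSimplex 5) := by
    rintro ⟨M, hM⟩
    set ε : ℝ := min 1 (1 / ((|M| + 1) * (6 : ℝ) ^ Nsum)) with hε_def
    have h6 : (0 : ℝ) < (6 : ℝ) ^ Nsum := by positivity
    have hK : 0 < (|M| + 1) * (6 : ℝ) ^ Nsum := by positivity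
    have hεpos : 0 < ε := lt_min one_pos (by positivity)
    have hε1 : ε ≤ 1 := min_le_left _ _
    have hεK : ε ≤ 1 / ((|M| + 1) * (6 : ℝ) ^ Nsum) := min_le_right _ _
    set t := simplexPoint (gε ε) with ht
    have htmem : t ∈ openSimplex 5 := simplexPoint_mem (hgpos ε hεpos)
    have hval : rayF pi8dualInv (bzDen a) (bzNum a) t = phiZ a (gε ε) := by
      rw [rayF_dual_eq_phiZ, ht, funext (gap_simplexPoint (hgpos ε hεpos)),
        phiZ_smul a (inv_pos.2 (gsum_pos (hgpos ε hεpos))).ne']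
    have hle := hM ⟨t, htmem, rfl⟩
    rw [hval] at hle
    have hge := hphi ε hεpos hε1
    -- `ε⁻¹ / 6^N ≥ |M| + 1 > M`
    have h2 : |M| + 1 ≤ ε⁻¹ / (6 : ℝ) ^ Nsum := by
      rw [le_div_iff₀ h6, ← one_div, le_div_iff₀ hεpos]
      calc (|M| + 1) * (6 : ℝ) ^ Nsum * ε ≤ (|M| + 1) * (6 : ℝ) ^ Nsum * (1 / ((|M| + 1) * (6 : ℝ) ^ Nsum)) :=
            mul_le_mul_of_nonneg_left hεK hK.le
        _ = 1 := by field_simp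
    linarith [le_abs_self M]
  unfold raySup
  exact Real.sSup_of_not_bddAbove hnot

end DualRate

end Summit.KontsevichZagierPeriods.Zeta5Search.Families.Cellular
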